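import Literature.Probability.LatticeModels.GridDomainBoundaryHittingProofs
import Literature.Probability.LatticeModels.GridDomainConformalSteps
import Mathlib.Algebra.Order.Archimedean.Basic
import HarnessLib

/-!
# Boundary hitting in grid domains (LSW 2004, Lemma 5.3) — proved steps, III:
# the lemma follows from its one-round case by iteration

Topic `Literature/Probability/LatticeModels`; third sibling of `GridDomainHittingProbability.lean`
(the named fact `boundaryHitting`, G. F. Lawler, O. Schramm, W. Werner, *Conformal invariance of
planar loop-erased random walks and uniform spanning trees*, Ann. Probab. 32 (2004), Lemma 5.3;
arXiv math/0112234, Lemma 33). The printed proof (§5.1) first establishes the lemma "in the case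
where `ε₂` is very close to `1`" — from a vertex `w` with `1 - |ψ_D(w)| ≤ δ` the walk exits `D`
before reaching conformal distance `ε₁` from `w` with probability at least a universal `c > 0`,
provided `δ/ε₁` is small — and concludes:

> "The Koebe distortion theorem implies that there is a constant `c > 0` such that if
> `v₁, v₂ ∈ V(D)` are neighbors, then `1 - |ψ_D(v₂)| ≤ c (1 - |ψ_D(v₁)|). […] Consequently, we may
> iterate the above restricted case of the lemma and use the Markov property, thereby proving the
> lemma for arbitrary `ε₂ > 0`."

This file PROVES that last step, `LSWGrid.boundaryHitting_of_oneRound`: **the named fact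
`boundaryHitting` follows from its one-round case**, stated as the hypothesis

  `(ORH)` there are `M ≥ 0`, `c₂ ∈ (0, 1]`, `δ₀ > 0` such that for every `D ∈ 𝔇`, every disc map
  `ψ` of `D` and every `w ∈ V(D)` with `1 - ‖ψ w‖ ≤ δ₀` there is a finite set `N ∋ w` of sites, all
  of whose points in `V(D)` are within `M (1 - ‖ψ w‖)` of `ψ w` in conformal coordinates, which the
  walk from `w` leaves before being killed with probability at most `1 - c₂`
  (`hitBeforeExitProb D w (V(D) ∖ N) ≤ 1 - c₂`)

— the restricted case of the printed proof with the round confined to a finite set (as the printed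
channel argument provides: the round is played inside `B(z₁, r) ∪ B(w, r/8)`, `r = dist(w, ∂D)`).
The two ingredients are the tree's
`LSWGrid.IsGridDomain.norm_sub_le_of_adj` (`GridDomainConformalSteps.lean`: neighbours satisfy
`‖ψ v₂ - ψ v₁‖ ≤ 14 (1 - ‖ψ v₁‖)`, the quoted Koebe step) and, in place of the strong Markov
property, the comparison principle for killed-harmonic functions on the finite round set
(`LSWGrid.hitBeforeExitProb_le_mul_of_exit_bound`: the hitting probability of the far target is at
most (the probability of leaving the round set alive) × (its maximum over the exit sites), since
both sides are killed-harmonic on `N` — `GridDomainBoundaryHittingProofs.lean` — and the inequality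
holds on the exit sites). The iteration: with `Λ = 15 (1 + M)`, after `j` rounds started at
conformal distance `η` from the boundary the walk is conformally within `(Λ^j - 1) η` of its start
and at conformal distance `≤ Λ^j η` from the boundary, and survives them unkilled with probability
`≤ (1 - c₂)^j` (`LSWGrid.hitBeforeExitProb_le_pow_of_oneRound`); `δ(ε₁, ε₂) = min(ε₁/Λ^k, δ₀/Λ^k)`
with `(1 - c₂)^k ≤ ε₂`.

Everything here is proved; no definition and no named fact is introduced, and `(ORH)` enters only
as an explicit hypothesis of the two theorems (it is the part of Lemma 5.3 that remains to be
formalised: conformal invariance of Brownian harmonic measure, the three-channel topology and the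
random-walk channel estimate of the printed proof).

## References

* G. F. Lawler, O. Schramm, W. Werner, Ann. Probab. 32 (2004) 939–995, §5.1, proof of Lemma 5.3
  (last paragraph) [LawlerSchrammWerner2004].
* G. F. Lawler, V. Limic, *Random Walk: A Modern Introduction*, CUP (2010), §6.1 (maximum principle
  for the killed walk) [LawlerLimic2010].
-/

noncomputable section

open Set Metric
open scoped Classical
open Literature.Probability.RandomPlanarGeometry (ChordalLERW.siteGraph ChordalLERW.siteGraph_adj_iff)

namespace Literature.Probability.LatticeModels

namespace LSWGrid

variable {D : Set ℂ}

/-- **First-exit bound** (the strong Markov property at the exit time of a finite set, in the form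
of an inequality between killed-harmonic functions). Let `N` be a finite set of sites disjoint from
the target `B`, and let `m` bound `hitBeforeExitProb D · B` at every site of `V(D) ∖ N` joined to a
site of `N ∩ V(D)` by a lattice edge (the sites where the walk started in `N` can sit when it first
leaves `N` alive). Then for `w ∈ N`:
`hitBeforeExitProb D w B ≤ m · hitBeforeExitProb D w (V(D) ∖ N)` — to reach `B` the walk must
first leave `N` alive, and from the exit site its chances are at most `m`. Proof: both sides are
harmonic for the killed walk on the finite set `N` and the inequality holds on its outer boundary
(comparison principle of `KilledWalkLaplacian.lean`). [folklore] -/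
theorem hitBeforeExitProb_le_mul_of_exit_bound {N B : Set (Site 2)} (hN : N.Finite)
    (hNB : Disjoint N B) {m : ℝ}
    (hm : ∀ x ∈ latticeVertices D, x ∉ N →
      (∃ v ∈ N, v ∈ latticeVertices D ∧ (zdGraph 2).Adj v x) → hitBeforeExitProb D x B ≤ m) :
    ∀ w ∈ N, hitBeforeExitProb D w B ≤ m * hitBeforeExitProb D w (latticeVertices D \ N) := by
  set V := latticeVertices D with hV
  have hh : IsKilledHarmonicOn (ChordalLERW.siteGraph V) (fun v => hitBeforeExitProb D v B) N :=
    (hitBeforeExitProb_isKilledHarmonicOn D B).mono fun v hv hvB => Set.disjoint_left.1 hNB hv hvB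
  have hq : IsKilledHarmonicOn (ChordalLERW.siteGraph V)
      (fun v => m * hitBeforeExitProb D v (V \ N)) N :=
    ((hitBeforeExitProb_isKilledHarmonicOn D (V \ N)).mono fun v hv hvVN => hvVN.2 hv).const_mul m
  refine le_of_killedSub_killedSuper_of_boundary hN hh.subharmonicOn hq.superharmonicOn ?_
  rintro x ⟨hxN, v, hv, e, rfl, hadj⟩
  obtain ⟨hzd, hvV, hxV⟩ := ChordalLERW.siteGraph_adj_iff.1 hadj
  have hq1 : hitBeforeExitProb D (v + SRW.stepVec e) (V \ N) = 1 :=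
    hitBeforeExitProb_eq_one_of_mem D ⟨hxV, hxN⟩
  change hitBeforeExitProb D (v + SRW.stepVec e) B ≤ m * hitBeforeExitProb D (v + SRW.stepVec e) (V \ N)
  rw [hq1, mul_one]
  exact hm _ hxV hxN ⟨v, hv, hvV, hzd⟩

section OneRound

variable {M c₂ δ₀ : ℝ}

/-- **The rounds multiply** (the iteration of the printed proof). Assume the one-round hypothesis
`(ORH)` with constants `M ≥ 0`, `c₂ ≤ 1`, `δ₀`, and put `Λ = 15 (1 + M)`. Let `D ∈ 𝔇`, `ψ` a disc
map of `D`, `w₀ ∈ V(D)`, `ε₁ > 0`, `B = {v ∈ V(D) : ε₁ < ‖ψ v - ψ w₀‖}`. Then for every `j` and every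
`x ∈ V(D)` with `‖ψ x - ψ w₀‖ + (Λ^j - 1)(1 - ‖ψ x‖) ≤ ε₁` and `Λ^j (1 - ‖ψ x‖) ≤ δ₀`:
`hitBeforeExitProb D x B ≤ (1 - c₂)^j`. Induction on `j`: a round from `x` (conformal distance `η`
to the boundary) stays conformally within `M η` of `x`, so off `B`; it ends unkilled with
probability `≤ 1 - c₂`, at a lattice neighbour `y` of a point of the round set, whence
`‖ψ y - ψ x‖ ≤ (Λ - 1) η` and `1 - ‖ψ y‖ ≤ Λ η` (`IsGridDomain.norm_sub_le_of_adj`), so that the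
induction hypothesis applies at `y`; conclude by `hitBeforeExitProb_le_mul_of_exit_bound`.
[cite: LawlerSchrammWerner2004, §5.1, proof of Lemma 5.3] -/
theorem hitBeforeExitProb_le_pow_of_oneRound (hM : 0 ≤ M) (hc₂1 : c₂ ≤ 1)
    (H : ∀ D : Set ℂ, IsClassD D → ∀ ψ : ℂ → ℂ, IsDiscMap D ψ → ∀ w ∈ latticeVertices D,
      1 - ‖ψ (Site.toComplex w)‖ ≤ δ₀ → ∃ N : Set (Site 2), N.Finite ∧ w ∈ N ∧
        (∀ v ∈ N, v ∈ latticeVertices D →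
          ‖ψ (Site.toComplex v) - ψ (Site.toComplex w)‖ ≤ M * (1 - ‖ψ (Site.toComplex w)‖)) ∧
        hitBeforeExitProb D w (latticeVertices D \ N) ≤ 1 - c₂)
    (hD : IsClassD D) {ψ : ℂ → ℂ} (hψ : IsDiscMap D ψ) (w₀ : Site 2) {ε₁ : ℝ} (j : ℕ) :
    ∀ x ∈ latticeVertices D,
      ‖ψ (Site.toComplex x) - ψ (Site.toComplex w₀)‖ +
          ((15 * (1 + M)) ^ j - 1) * (1 - ‖ψ (Site.toComplex x)‖) ≤ ε₁ →
      (15 * (1 + M)) ^ j * (1 - ‖ψ (Site.toComplex x)‖) ≤ δ₀ →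
      hitBeforeExitProb D x {v | v ∈ latticeVertices D ∧
        ε₁ < ‖ψ (Site.toComplex v) - ψ (Site.toComplex w₀)‖} ≤ (1 - c₂) ^ j := by
  set V := latticeVertices D with hV
  set Λ : ℝ := 15 * (1 + M) with hΛ
  set B : Set (Site 2) := {v | v ∈ V ∧ ε₁ < ‖ψ (Site.toComplex v) - ψ (Site.toComplex w₀)‖} with hB
  have hΛ1 : 1 ≤ Λ := by rw [hΛ]; nlinarith
  have hgrid : IsGridDomain D := hD.1
  have hdiff : DifferentiableOn ℂ ψ D := hψ.1
  have hmaps : MapsTo ψ D (ball 0 1) := hψ.2.1.mapsTo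
  have hnorm_lt : ∀ x ∈ V, ‖ψ (Site.toComplex x)‖ < 1 := fun x hx =>
    mem_ball_zero_iff.1 (hmaps hx)
  induction j with
  | zero =>
      intro x _ _ _
      rw [pow_zero]
      exact hitBeforeExitProb_le_one D x B
  | succ j ih =>
      intro x hx h1 h2
      set η : ℝ := 1 - ‖ψ (Site.toComplex x)‖ with hη
      have hη0 : 0 ≤ η := by have := hnorm_lt x hx; rw [hη]; linarith
      have hΛj : 1 ≤ Λ ^ j := one_le_pow₀ hΛ1
      have hΛj1 : 1 ≤ Λ ^ (j + 1) := one_le_pow₀ hΛ1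
      have hηδ : η ≤ δ₀ := le_trans (by nlinarith) h2
      obtain ⟨N, hNfin, hxN, hNclose, hround⟩ := H D hD ψ hψ x hx hηδ
      -- the round set misses the target
      have hMΛ : M ≤ Λ ^ (j + 1) - 1 := by
        have : Λ ≤ Λ ^ (j + 1) := by
          calc Λ = Λ ^ 1 := (pow_one Λ).symm
            _ ≤ Λ ^ (j + 1) := pow_le_pow_right₀ hΛ1 (by omega)
        rw [hΛ] at this ⊢; nlinarith
      have hNB : Disjoint N B := by
        refine Set.disjoint_left.2 fun v hvN hvB => ?_
        obtain ⟨hvV, hvfar⟩ := hvB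
        have hclose := hNclose v hvN hvV
        have : ‖ψ (Site.toComplex v) - ψ (Site.toComplex w₀)‖ ≤ ε₁ := by
          calc ‖ψ (Site.toComplex v) - ψ (Site.toComplex w₀)‖
              = ‖(ψ (Site.toComplex v) - ψ (Site.toComplex x)) + (ψ (Site.toComplex x) - ψ (Site.toComplex w₀))‖ := by
                  ring_nf
            _ ≤ ‖ψ (Site.toComplex v) - ψ (Site.toComplex x)‖ + ‖ψ (Site.toComplex x) - ψ (Site.toComplex w₀)‖ :=
                  norm_add_le _ _
            _ ≤ M * η + ‖ψ (Site.toComplex x) - ψ (Site.toComplex w₀)‖ := by gcongr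
            _ ≤ (Λ ^ (j + 1) - 1) * η + ‖ψ (Site.toComplex x) - ψ (Site.toComplex w₀)‖ := by gcongr
            _ ≤ ε₁ := by linarith
        linarith
      -- the exit sites of the round satisfy the induction hypothesis
      have hexit : ∀ y ∈ V, y ∉ N → (∃ v ∈ N, v ∈ V ∧ (zdGraph 2).Adj v y) →
          hitBeforeExitProb D y B ≤ (1 - c₂) ^ j := by
        rintro y hyV - ⟨v, hvN, hvV, hadj⟩
        have hclose := hNclose v hvN hvV
        have hstep := hgrid.norm_sub_le_of_adj hdiff hmaps hvV hyV hadj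
        -- conformal distance of `v` and displacement of `y`
        have huv : 1 - ‖ψ (Site.toComplex v)‖ ≤ (1 + M) * η := by
          have : ‖ψ (Site.toComplex x)‖ ≤ ‖ψ (Site.toComplex v)‖ + ‖ψ (Site.toComplex v) - ψ (Site.toComplex x)‖ := by
            calc ‖ψ (Site.toComplex x)‖ = ‖ψ (Site.toComplex v) - (ψ (Site.toComplex v) - ψ (Site.toComplex x))‖ := by
                  ring_nf
              _ ≤ _ := norm_sub_le _ _
          nlinarith
        have hyx : ‖ψ (Site.toComplex y) - ψ (Site.toComplex x)‖ ≤ (Λ - 1) * η := by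
          calc ‖ψ (Site.toComplex y) - ψ (Site.toComplex x)‖
              = ‖(ψ (Site.toComplex y) - ψ (Site.toComplex v)) + (ψ (Site.toComplex v) - ψ (Site.toComplex x))‖ := by
                  ring_nf
            _ ≤ ‖ψ (Site.toComplex y) - ψ (Site.toComplex v)‖ + ‖ψ (Site.toComplex v) - ψ (Site.toComplex x)‖ :=
                  norm_add_le _ _
            _ ≤ 14 * (1 - ‖ψ (Site.toComplex v)‖) + M * η := add_le_add hstep hclose
            _ ≤ 14 * ((1 + M) * η) + M * η := by gcongr
            _ = (Λ - 1) * η := by rw [hΛ]; ring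
        have huy : 1 - ‖ψ (Site.toComplex y)‖ ≤ Λ * η := by
          have : ‖ψ (Site.toComplex x)‖ ≤ ‖ψ (Site.toComplex y)‖ + ‖ψ (Site.toComplex y) - ψ (Site.toComplex x)‖ := by
            calc ‖ψ (Site.toComplex x)‖ = ‖ψ (Site.toComplex y) - (ψ (Site.toComplex y) - ψ (Site.toComplex x))‖ := by
                  ring_nf
              _ ≤ _ := norm_sub_le _ _
          nlinarith
        have hyw : ‖ψ (Site.toComplex y) - ψ (Site.toComplex w₀)‖ ≤
            ‖ψ (Site.toComplex x) - ψ (Site.toComplex w₀)‖ + (Λ - 1) * η := by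
          calc ‖ψ (Site.toComplex y) - ψ (Site.toComplex w₀)‖
              = ‖(ψ (Site.toComplex y) - ψ (Site.toComplex x)) + (ψ (Site.toComplex x) - ψ (Site.toComplex w₀))‖ := by
                  ring_nf
            _ ≤ ‖ψ (Site.toComplex y) - ψ (Site.toComplex x)‖ + ‖ψ (Site.toComplex x) - ψ (Site.toComplex w₀)‖ :=
                  norm_add_le _ _
            _ ≤ _ := by linarith
        have huy0 : 0 ≤ 1 - ‖ψ (Site.toComplex y)‖ := by have := hnorm_lt y hyV; linarith
        refine ih y hyV ?_ ?_
        · -- displacement budget: `(Λ - 1) η + (Λ^j - 1) Λ η = (Λ^{j+1} - 1) η`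
          have hpow : Λ ^ (j + 1) = Λ ^ j * Λ := pow_succ Λ j
          have key : (Λ ^ j - 1) * (1 - ‖ψ (Site.toComplex y)‖) ≤ (Λ ^ j - 1) * (Λ * η) :=
            mul_le_mul_of_nonneg_left huy (by linarith)
          have : ‖ψ (Site.toComplex x) - ψ (Site.toComplex w₀)‖ + (Λ - 1) * η + (Λ ^ j - 1) * (Λ * η)
              = ‖ψ (Site.toComplex x) - ψ (Site.toComplex w₀)‖ + (Λ ^ (j + 1) - 1) * η := by
            rw [hpow]; ring
          linarith
        · calc Λ ^ j * (1 - ‖ψ (Site.toComplex y)‖) ≤ Λ ^ j * (Λ * η) :=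
                mul_le_mul_of_nonneg_left huy (by linarith)
            _ = Λ ^ (j + 1) * η := by rw [pow_succ]; ring
            _ ≤ δ₀ := h2
      -- first-exit bound and the round estimate
      have hpow0 : 0 ≤ (1 - c₂) ^ j := pow_nonneg (by linarith) j
      have hfe := hitBeforeExitProb_le_mul_of_exit_bound hNfin hNB hexit x hxN
      calc hitBeforeExitProb D x B ≤ (1 - c₂) ^ j * hitBeforeExitProb D x (V \ N) := hfe
        _ ≤ (1 - c₂) ^ j * (1 - c₂) := mul_le_mul_of_nonneg_left hround hpow0
        _ = (1 - c₂) ^ (j + 1) := (pow_succ _ _).symm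

/-- **Lawler–Schramm–Werner's Lemma 5.3 follows from its one-round case.** Under the one-round
hypothesis `(ORH)` (module docstring) the named fact `boundaryHitting` holds: given `ε₁, ε₂ > 0`,
choose `k` with `(1 - c₂)^k ≤ ε₂` and `δ = min(ε₁, δ₀)/Λ^k`, `Λ = 15(1 + M)`; a start `w` with
`1 - ‖ψ w‖ ≤ δ` satisfies the hypotheses of `hitBeforeExitProb_le_pow_of_oneRound` with `j = k`
and `x = w₀ = w`. ("Consequently, we may iterate the above restricted case of the lemma and use the
Markov property, thereby proving the lemma for arbitrary `ε₂ > 0`.")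
[cite: LawlerSchrammWerner2004, §5.1, proof of Lemma 5.3] -/
theorem boundaryHitting_of_oneRound (hM : 0 ≤ M) (hc₂ : 0 < c₂) (hc₂1 : c₂ ≤ 1) (hδ₀ : 0 < δ₀)
    (H : ∀ D : Set ℂ, IsClassD D → ∀ ψ : ℂ → ℂ, IsDiscMap D ψ → ∀ w ∈ latticeVertices D,
      1 - ‖ψ (Site.toComplex w)‖ ≤ δ₀ → ∃ N : Set (Site 2), N.Finite ∧ w ∈ N ∧
        (∀ v ∈ N, v ∈ latticeVertices D →
          ‖ψ (Site.toComplex v) - ψ (Site.toComplex w)‖ ≤ M * (1 - ‖ψ (Site.toComplex w)‖)) ∧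
        hitBeforeExitProb D w (latticeVertices D \ N) ≤ 1 - c₂) :
    boundaryHitting := by
  intro ε₁ ε₂ hε₁ hε₂
  set Λ : ℝ := 15 * (1 + M) with hΛ
  have hΛ1 : 1 ≤ Λ := by rw [hΛ]; nlinarith
  obtain ⟨k, hk⟩ : ∃ k : ℕ, (1 - c₂) ^ k < ε₂ := exists_pow_lt_of_lt_one hε₂ (by linarith)
  have hΛk : 1 ≤ Λ ^ k := one_le_pow₀ hΛ1
  have hΛk0 : 0 < Λ ^ k := by linarith
  refine ⟨min ε₁ δ₀ / Λ ^ k, div_pos (lt_min hε₁ hδ₀) hΛk0, ?_⟩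
  intro D hD ψ hψ w hw hwδ
  set η : ℝ := 1 - ‖ψ (Site.toComplex w)‖ with hη
  have hηle : η ≤ min ε₁ δ₀ / Λ ^ k := by rw [hη]; linarith
  have hη0 : 0 ≤ η := by
    have : ‖ψ (Site.toComplex w)‖ < 1 := mem_ball_zero_iff.1 (hψ.2.1.mapsTo hw)
    rw [hη]; linarith
  have hmul : Λ ^ k * η ≤ min ε₁ δ₀ := by
    calc Λ ^ k * η ≤ Λ ^ k * (min ε₁ δ₀ / Λ ^ k) := mul_le_mul_of_nonneg_left hηle hΛk0.le
      _ = min ε₁ δ₀ := mul_div_cancel₀ _ hΛk0.ne'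
  have h := hitBeforeExitProb_le_pow_of_oneRound hM hc₂1 H hD hψ w (ε₁ := ε₁) k w hw
    (by
      rw [sub_self, norm_zero, zero_add]
      calc (Λ ^ k - 1) * η ≤ Λ ^ k * η := by nlinarith
        _ ≤ min ε₁ δ₀ := hmul
        _ ≤ ε₁ := min_le_left _ _)
    (hmul.trans (min_le_right _ _))
  exact h.trans hk.le

end OneRound

end LSWGrid

end Literature.Probability.LatticeModels
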